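import Literature.Analysis.FluidPDE.TorusClassicalNSL2H4Smoothing

/-!
# The `L²_t H⁴` smoothing bound on `T³` (tools stub `stub_l2H4SmoothingTools`, block N-E, line
# `ergodic-budget-selection-closing`, crux `BaireTransfer.DenseLoudDesignerForces`, stmt-AnomalousDissipation-1143)

Summit-side specialisation to `T³ = UnitAddTorus (Fin 3)` of the Literature estimate
`Torus.IsClassicalNSSolutionOn.intervalIntegral_norm_laplacian_laplacian_sq_le_of_le`
(`Literature/Analysis/FluidPDE/TorusClassicalNSL2H4Smoothing.lean`): for `ν > 0` and a classical solution of
NS_ν on `[a, a + τ] × T³` with zero-mean slices, sup bounds `‖∇u‖₂² ≤ E₁`, `‖Δu‖₂² ≤ Y₁`, `‖∇Δu‖₂² ≤ Z₁` and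
`‖Δf‖₂² ≤ G₂` on the interval give `∫ₐ^{a+τ} ‖Δ²u(s)‖₂² ds ≤ C(ν, E₁, Y₁, Z₁, G₂, τ)` — the `k = 3` differential
inequality (7.3) of Robinson–Rodrigo–Sadowski 2016, Thm 7.1, integrated in time.  This is the quantity through
which the continuation argument of block N-E (strong solutions near the invariant core) restarts the local existence
theorem from a time of controlled `H⁴` norm chosen by Chebyshev.  The registered tools stub
`stub_l2H4SmoothingTools` is proved BY NAME with exactly the registered signature.

References: Robinson–Rodrigo–Sadowski, *The Three-Dimensional Navier–Stokes Equations* (CUP 2016) Thm 7.1 (7.3);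
Constantin–Foias, *Navier–Stokes Equations* (1988) Thm 10.6.
-/

-- `Summit.<Summit>.<Problem>` is the tree's mandated summit-side namespace (CONVENTIONS §2); for this
-- single-conjunct summit the two coincide, so the duplicate is deliberate.
set_option linter.dupNamespace false

noncomputable section

open scoped BigOperators Topology ENNReal InnerProductSpace
open Filter Set Function MeasureTheory

namespace Summit.AnomalousDissipation.AnomalousDissipation.Theorems.DenseLoudDesignerForces.Ergodic

open Literature.Analysis.FunctionSpaces Literature.Analysis.FunctionSpaces.Torus
open Literature.Analysis.FluidPDE Literature.Analysis.FluidPDE.Torus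

/-- **Tools stub E4 of block N-E (`stub_l2H4SmoothingTools`, crux stmt-AnomalousDissipation-1143, line
`ergodic-budget-selection-closing`) — the `L²_t H⁴` smoothing bound.**  For `ν > 0` and a classical solution of
NS_ν on `[a, a + τ] × T³` with zero-mean slices, sup bounds `‖∇u‖₂² ≤ E₁`, `‖Δu‖₂² ≤ Y₁`, `‖∇Δu‖₂² ≤ Z₁` and
`‖Δf‖₂² ≤ G₂` on the interval give `∫ₐ^{a+τ} ‖Δ²u(s)‖₂² ds ≤ C(ν, E₁, Y₁, Z₁, G₂, τ)`: the `H³` balance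
`d/dt ½‖∇Δu‖₂² = −ν‖Δ²u‖₂² + ∫⟪(u·∇)u − f, Δ³u⟫` with the flux bound `≤ −(ν/2)‖Δ²u‖₂² + ν⁻¹(‖Δf‖₂² + ‖Δ((u·∇)u)‖₂²)`
and `‖Δ((u·∇)u)‖₂² ≤ C(‖∇u‖₂² + ‖Δu‖₂²)(‖Δu‖₂² + ‖∇Δu‖₂²)` on `T³`, integrated in time
(`Torus.IsClassicalNSSolutionOn.intervalIntegral_norm_laplacian_laplacian_sq_le_of_le` at `d = Fin 3`).
RRS 2016 Thm 7.1 (7.3), `k = 3`. [cite: RobinsonRodrigoSadowskiCUP2016, Thm 7.1 (7.3)] -/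
theorem stub_l2H4SmoothingTools {ν : ℝ} (hν : 0 < ν) (E₁ Y₁ Z₁ G₂ τ : ℝ) (hτ : 0 < τ) :
    ∃ C : ℝ, ∀ {a : ℝ} {f u : ℝ → (UnitAddTorus (Fin 3)) → (EuclideanSpace ℝ (Fin 3))} {p : ℝ → (UnitAddTorus (Fin 3)) → ℝ},
      IsClassicalNSSolutionOn (Icc a (a + τ)) ν f u p → (∀ t ∈ Icc a (a + τ), HasZeroMean (u t)) →
      (∀ t ∈ Icc a (a + τ), gradNormSq (u t) ≤ E₁) → (∀ t ∈ Icc a (a + τ), ∫ x, ‖laplacian (u t) x‖ ^ 2 ≤ Y₁) →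
      (∀ t ∈ Icc a (a + τ), gradNormSq (laplacian (u t)) ≤ Z₁) →
      (∀ t ∈ Icc a (a + τ), ∫ x, ‖laplacian (f t) x‖ ^ 2 ≤ G₂) →
      ∫ s in a..(a + τ), (∫ x, ‖laplacian (laplacian (u s)) x‖ ^ 2) ≤ C :=
  IsClassicalNSSolutionOn.intervalIntegral_norm_laplacian_laplacian_sq_le_of_le (d := Fin 3)
    (Fintype.card_fin 3) hν E₁ Y₁ Z₁ G₂ hτ

end Summit.AnomalousDissipation.AnomalousDissipation.Theorems.DenseLoudDesignerForces.Ergodic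

end
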